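import Literature.AlgebraicGeometry.Motives.HodgeStructureHodgeVectorBlockSubHodgeStructures
import HarnessLib

/-!
# THE HODGE-VECTOR BLOCK IS A SUM OF TATE STRUCTURES: `V₀ = V ∩ V^{m,m} ≅ ℚ(−m)^{dim V₀}` is pure of type `(m,m)` (every linear map out
# of it into Hodge vectors is a morphism), `h^{m,m}(V₀) = dim V₀`, `h^{p,q}(V₀) = 0` otherwise, and the Hodge numbers of `V` split:
# `h^{m,m}(V) = dim V₀ + h^{m,m}(V₀^⊥)`, `h^{p,q}(V) = h^{p,q}(V₀^⊥)` for `(p,q) ≠ (m,m)`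
# (Green–Griffiths–Kerr §I.A p. 33 (`ℚ(p)`, «pure Hodge type»), Ch. V Warning p. 154; Deligne, Hodge II, 1.2.5, 2.1.13; Voisin I §7.1.1, §7.3.1)

[topic AlgebraicGeometry/Motives]

Layer `Literature/AlgebraicGeometry/Motives`, lane `lit-hodgefound` (Track 2 foundations library; seat `lit-hodgefound-p02`, gen 41,
row g41-#6). THEOREMS ONLY: no definition, no named fact (D-0026 net debt `0`), no instance, no notation. Sequel BY NAME of g41-#2
`Motives/HodgeStructureHodgeVectorBlockSubHodgeStructures` (`V₀`, `V₀^⊥` as sub-Hodge structures; `…isCompl_of_eq_hodgeClasses_of_eq_orthogonal`,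
`SubHodgeStructure.hodgeClasses_toHodgeStructure_eq_top_of_le`), g41-#1 `Motives/HodgeStructureHodgeVectorCornerEndomorphisms`
(`baseChange_apply_mem_F_inf_complexConj_of_range_le_hodgeClasses`), the tree's exactness of Hodge numbers
(`hodgeNumber_eq_add_of_exact`, `Hom.hodgeNumber_eq_of_bijective`, `Motives/HodgeStructureQuotient`), `HodgeStructure.pure` (the
structure purely of type `(k,k)`, `Motives/HodgeStructure`), `SubHodgeStructure.subtypeHom` / `projectionOntoHom`. The statements
«`Hdgᵖ = V ⟹ Fᵖ = V_ℂ`, `F^{p'} = 0` (`p' > p`), `V^{p',q'} = 0` (`p' ≠ p`), `h^{p',q'} = 0`» exist in the tree for a Hodge structure `H`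
with `H.hodgeClasses p = ⊤` (`Motives/BettiRealizationPure`: `F_eq_top_of_hodgeClasses_eq_top`, `F_eq_bot_…`, `piece_eq_bot_…`,
`hodgeNumber_eq_zero_…`; not imported — that module sits on the Betti-realization cone); here they are re-derived for a sub-Hodge structure
`S ⊆ V₀` from g41-#1 §1 and cited by name. The bound `dim Hdgᵖ ≤ h^{p,p}` is the tree's `finrank_hodgeClasses_le_hodgeNumber`
(`Motives/HodgeStructureHodgeClassesFinrank`); §3 gives the exact defect `h^{m,m}(V) − dim V₀ = h^{m,m}(V₀^⊥)`.

## The sources, verbatim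

* M. Green, P. Griffiths, M. Kerr, *Mumford–Tate Groups and Domains* [GreenGriffithsKerr2012]: §I.A p. 33 «The Tate structure `ℚ(1)` is
  defined by `V = 2πiℚ ⊂ ℂ` … Thus `V` is of pure Hodge type `(−1,−1)`. … We denote by `ℚ(p)` the `p`-th tensor power of `ℚ(1)`»;
  Ch. V p. 154 Warning (sub-Hodge structures of pure type `(n/2, n/2)`).
* P. Deligne, *Théorie de Hodge II* [DeligneHodgeII1971]: 1.2.5 (the bigrading `V_ℂ = ⊕ V^{p,q}`, `Fᵖ = ⊕_{p' ≥ p} V^{p',q'}`), 1.2.10 (iv)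
  (`Gr_F` exact on strict sequences), 2.1.13 (the Tate structure `ℤ(1)`, «de type `(−1,−1)`»).
* C. Voisin, *Hodge Theory and Complex Algebraic Geometry I* [VoisinHodgeI2002]: §7.1.1 (Hodge numbers, the Hodge structure of a Hodge class),
  §7.3.1 p. 148 (morphisms; exact sequences of Hodge structures).

## The mechanism

If every vector of a sub-Hodge structure `S` is a Hodge vector (`S ⊆ V₀ = V ∩ V^{m,m}`), then `S_ℂ` consists of real vectors of `Fᵐ`, so
`Fᵐ(S) = conj Fᵐ(S) = S_ℂ` and, by opposedness, `F^{m+1}(S) = 0`: `S` is purely of type `(m,m)`, `S^{m,m} = S_ℂ`, `h^{m,m}(S) = dim_ℚ S`,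
all other pieces vanish (§1). A `ℚ`-linear map OUT of a pure `(m,m)` structure INTO the Hodge vectors of any `H₂` is a morphism (its
complexification maps `Fʳ = S_ℂ` (`r ≤ m`) into `ℂ ⊗ Hdgᵐ(H₂) ⊆ Fᵐ ⊆ Fʳ`, and `Fʳ = 0` for `r > m`), so any two pure `(m,m)` structures of the
same dimension are isomorphic and `V₀ ≅ ℚ(−m)^{dim V₀}` — on the tree's carrier, `S ≅ pure (Fin r → ℚ) m n` (§2). The split exact sequence
`0 → V₀ → V → V₀^⊥ → 0` of Hodge structures (inclusion and projection are morphisms) gives `h^{p,q}(V) = h^{p,q}(V₀) + h^{p,q}(V₀^⊥)` (§3).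

## What is proved (`m + m = n`; `S`, `T` sub-Hodge structures with `S.toSubmodule ≤ / = V₀ = H.hodgeClasses m`, `T.toSubmodule = V₀^⊥`)

* §1 (`S ⊆ V₀`) `SubHodgeStructure.F_toHodgeStructure_eq_top_of_le_hodgeClasses` (`Fʳ(S) = S_ℂ`, `r ≤ m`),
  `SubHodgeStructure.F_toHodgeStructure_eq_bot_of_le_hodgeClasses` (`Fʳ(S) = 0`, `r > m`), **`SubHodgeStructure.piece_toHodgeStructure_eq_top_of_le_hodgeClasses`**
  (`S^{m,m} = S_ℂ`), **`SubHodgeStructure.piece_toHodgeStructure_eq_bot_of_le_hodgeClasses`** (`S^{p,q} = 0`, `p ≠ m`),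
  **`SubHodgeStructure.hodgeNumber_toHodgeStructure_self_of_le_hodgeClasses`** (`h^{m,m}(S) = dim S`),
  `SubHodgeStructure.hodgeNumber_toHodgeStructure_eq_zero_of_le_hodgeClasses` (`h^{p,q}(S) = 0`, `p ≠ m`).
* §2 **`exists_hom_toLinearMap_eq_of_hodgeClasses_eq_top`** (every `ℚ`-linear `f : V₁ → V₂` from `H₁` with `Hdgᵐ(H₁) = V₁` INTO `Hdgᵐ(H₂)`
  underlies a morphism `H₁ → H₂`), `exists_hom_bijective_of_hodgeClasses_eq_top` (two pure `(m,m)` structures with a linear isomorphism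
  between them are isomorphic Hodge structures), `hodgeClasses_pure_eq_top` (the tree's `pure W m n` has `Hdgᵐ = W`),
  **`SubHodgeStructure.exists_hom_pure_bijective_of_le_hodgeClasses`** (`S ≅ pure (Fin (dim S) → ℚ) m n = ℚ(−m)^{dim S}`).
* §3 **`Polarization.hodgeNumber_eq_add_of_eq_orthogonal`** (`h^{p,q}(V) = h^{p,q}(V₀) + h^{p,q}(V₀^⊥)` via the split exact sequence),
  **`Polarization.hodgeNumber_self_eq_finrank_hodgeClasses_add`** (`h^{m,m}(V) = dim V₀ + h^{m,m}(V₀^⊥)`),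
  **`Polarization.hodgeNumber_eq_hodgeNumber_toHodgeStructure_of_ne`** (`h^{p,q}(V) = h^{p,q}(V₀^⊥)` for `p ≠ m`),
  `Polarization.hodgeNumber_toHodgeStructure_self_eq_sub` (`h^{m,m}(V₀^⊥) = h^{m,m}(V) − dim V₀`).

## References

* [GreenGriffithsKerr2012] M. Green, P. Griffiths, M. Kerr, *Mumford–Tate Groups and Domains*, Ann. of Math. Stud. 183 (2012): §I.A p. 33; Ch. V p. 154.
* [DeligneHodgeII1971] P. Deligne, *Théorie de Hodge II*, Publ. Math. IHÉS 40 (1971): 1.2.5, 1.2.10 (iv), 2.1.13.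
* [VoisinHodgeI2002] C. Voisin, *Hodge Theory and Complex Algebraic Geometry I*, CUP (2002): §7.1.1; §7.3.1 (p. 148).
-/

noncomputable section

open Module
open scoped TensorProduct

namespace Literature.AlgebraicGeometry.Motives

namespace HodgeStructure

universe u v

variable {V : Type u} [AddCommGroup V] [Module ℚ V] [Module.Finite ℚ V] {n : ℤ} {H : HodgeStructure V n}
variable {V' : Type v} [AddCommGroup V'] [Module ℚ V']

/-! ## §0 Pure type `(m,m)`: `Hdgᵐ = V ⟹ Fᵐ = V_ℂ`, `F^{m+1} = 0` (private copies of the tree's `Motives/BettiRealizationPure` lemmas) -/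

omit [Module.Finite ℚ V] in
/-- If `im f ⊆ Hdgᵐ(H)` for a `ℚ`-linear `f : V' → V`, then `f_ℂ` takes values in `Fᵐ ∩ conj Fᵐ` (`f_ℂ(c ⊗ u) = c · (1 ⊗ f u)` with `1 ⊗ f u ∈ Fᵐ`
real; the two-space form of g41-#1's `baseChange_apply_mem_F_inf_complexConj_of_range_le_hodgeClasses`). [cite: GreenGriffithsKerr2012, §I.B p. 36] -/
private theorem baseChange_apply_mem_F_inf_complexConj_of_range_le₉ (H : HodgeStructure V n) {f : V' →ₗ[ℚ] V} {m : ℤ}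
    (hf : LinearMap.range f ≤ H.hodgeClasses m) (y : ℂ ⊗[ℚ] V') : f.baseChange ℂ y ∈ H.F m ⊓ complexConj (H.F m) := by
  induction y using TensorProduct.induction_on with
  | zero => rw [map_zero]; exact Submodule.zero_mem _
  | add x y hx hy => rw [map_add]; exact Submodule.add_mem _ hx hy
  | tmul c u =>
    have hu : ofRat (f u) ∈ H.F m := (H.mem_hodgeClasses_iff m (f u)).1 (hf ⟨u, rfl⟩)
    have hcu : (c ⊗ₜ[ℚ] f u : ℂ ⊗[ℚ] V) = c • (ofRat (f u) : ℂ ⊗[ℚ] V) := by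
      rw [ofRat_apply, TensorProduct.smul_tmul', smul_eq_mul, mul_one]
    rw [LinearMap.baseChange_tmul, hcu]
    refine Submodule.smul_mem _ c (Submodule.mem_inf.2 ⟨hu, ?_⟩)
    rw [mem_complexConj, conj_ofRat]
    exact hu

omit [Module.Finite ℚ V] in
/-- `Hdgᵐ(H) = V ⟹ Fʳ = V_ℂ` for `r ≤ m` (the tree's `F_eq_top_of_hodgeClasses_eq_top`, via g41-#1 §1). [cite: VoisinHodgeI2002, §7.1.1] -/
private theorem F_eq_top_of_hodgeClasses_eq_top₉ (H : HodgeStructure V n) {m : ℤ} (h : H.hodgeClasses m = ⊤) {r : ℤ} (hr : r ≤ m) :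
    H.F r = ⊤ := by
  refine eq_top_iff.2 fun x _ => H.antitone_F hr ?_
  have hx := baseChange_apply_mem_F_inf_complexConj_of_range_le₉ H (f := (LinearMap.id : V →ₗ[ℚ] V)) (m := m) (h ▸ le_top) x
  rw [LinearMap.baseChange_id, LinearMap.id_apply] at hx
  exact (Submodule.mem_inf.1 hx).1

omit [Module.Finite ℚ V] in
/-- `Hdgᵐ(H) = V`, `m + m = n ⟹ Fʳ = 0` for `r > m` (opposedness against `conj F^{n+1-r} = V_ℂ`; the tree's `F_eq_bot_of_hodgeClasses_eq_top`).
[cite: DeligneHodgeII1971, 1.2.5] -/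
private theorem F_eq_bot_of_hodgeClasses_eq_top₉ (H : HodgeStructure V n) {m : ℤ} (hm : m + m = n) (h : H.hodgeClasses m = ⊤) {r : ℤ}
    (hr : m < r) : H.F r = ⊥ := by
  have htop : H.F (n + 1 - r) = ⊤ := F_eq_top_of_hodgeClasses_eq_top₉ H h (by omega)
  have hc := (H.isCompl_F_complexConj r (n + 1 - r) (by omega)).disjoint
  rw [htop, complexConj_top, disjoint_top] at hc
  exact hc

/-! ## §1 A sub-Hodge structure of Hodge vectors is purely of type `(m,m)`: filtration, pieces, Hodge numbers -/

omit [Module.Finite ℚ V] in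
/-- **`Fʳ(S) = S_ℂ` for `r ≤ m`** when `S ⊆ V₀ = V ∩ V^{m,m}`. [cite: VoisinHodgeI2002, §7.1.1] [cite: GreenGriffithsKerr2012, §I.A p. 33] -/
theorem SubHodgeStructure.F_toHodgeStructure_eq_top_of_le_hodgeClasses (S : SubHodgeStructure H) {m : ℤ} (hS : S.toSubmodule ≤ H.hodgeClasses m)
    {r : ℤ} (hr : r ≤ m) : S.toHodgeStructure.F r = ⊤ :=
  F_eq_top_of_hodgeClasses_eq_top₉ _ (S.hodgeClasses_toHodgeStructure_eq_top_of_le hS) hr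

omit [Module.Finite ℚ V] in
/-- **`Fʳ(S) = 0` for `r > m`** when `S ⊆ V₀` (`m + m = n`). [cite: DeligneHodgeII1971, 1.2.5] -/
theorem SubHodgeStructure.F_toHodgeStructure_eq_bot_of_le_hodgeClasses (S : SubHodgeStructure H) {m : ℤ} (hm : m + m = n)
    (hS : S.toSubmodule ≤ H.hodgeClasses m) {r : ℤ} (hr : m < r) : S.toHodgeStructure.F r = ⊥ :=
  F_eq_bot_of_hodgeClasses_eq_top₉ _ hm (S.hodgeClasses_toHodgeStructure_eq_top_of_le hS) hr

omit [Module.Finite ℚ V] in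
/-- **`S^{m,m} = S_ℂ`**: a sub-Hodge structure of Hodge vectors is purely of type `(m,m)`. [cite: GreenGriffithsKerr2012, §I.A p. 33 and Ch. V Warning p. 154]
[cite: DeligneHodgeII1971, 1.2.5] -/
theorem SubHodgeStructure.piece_toHodgeStructure_eq_top_of_le_hodgeClasses (S : SubHodgeStructure H) {m : ℤ} (hm : m + m = n)
    (hS : S.toSubmodule ≤ H.hodgeClasses m) : S.toHodgeStructure.piece m m = ⊤ := by
  rw [S.toHodgeStructure.piece_of_add_eq hm, S.F_toHodgeStructure_eq_top_of_le_hodgeClasses hS le_rfl, complexConj_top, inf_top_eq]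

omit [Module.Finite ℚ V] in
/-- **`S^{p,q} = 0` for `p ≠ m`** when `S ⊆ V₀`. [cite: DeligneHodgeII1971, 1.2.5] [cite: GreenGriffithsKerr2012, §I.A p. 33] -/
theorem SubHodgeStructure.piece_toHodgeStructure_eq_bot_of_le_hodgeClasses (S : SubHodgeStructure H) {m : ℤ} (hm : m + m = n)
    (hS : S.toSubmodule ≤ H.hodgeClasses m) {p q : ℤ} (hp : p ≠ m) : S.toHodgeStructure.piece p q = ⊥ := by
  by_cases hpq : p + q = n
  · rcases lt_or_gt_of_ne hp with hlt | hlt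
    · refine eq_bot_iff.2 ((S.toHodgeStructure.piece_le_complexConj_F p q).trans ?_)
      rw [S.F_toHodgeStructure_eq_bot_of_le_hodgeClasses hm hS (show m < q by omega), complexConj_bot]
    · refine eq_bot_iff.2 ((S.toHodgeStructure.piece_le_F p q).trans ?_)
      rw [S.F_toHodgeStructure_eq_bot_of_le_hodgeClasses hm hS hlt]
  · exact S.toHodgeStructure.piece_eq_bot_of_add_ne hpq

/-- **`h^{m,m}(S) = dim_ℚ S`** for a sub-Hodge structure of Hodge vectors (`S^{m,m} = S_ℂ` and `dim_ℂ S_ℂ = dim_ℚ S`).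
[cite: VoisinHodgeI2002, §7.1.1] [cite: GreenGriffithsKerr2012, §I.A p. 33] -/
theorem SubHodgeStructure.hodgeNumber_toHodgeStructure_self_of_le_hodgeClasses (S : SubHodgeStructure H) {m : ℤ}
    (hm : m + m = n) (hS : S.toSubmodule ≤ H.hodgeClasses m) : S.toHodgeStructure.hodgeNumber m m = finrank ℚ S.toSubmodule := by
  rw [hodgeNumber, S.piece_toHodgeStructure_eq_top_of_le_hodgeClasses hm hS, finrank_top, Module.finrank_baseChange]

omit [Module.Finite ℚ V] in
/-- **`h^{p,q}(S) = 0` for `p ≠ m`** when `S ⊆ V₀`. [cite: VoisinHodgeI2002, §7.1.1] -/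
theorem SubHodgeStructure.hodgeNumber_toHodgeStructure_eq_zero_of_le_hodgeClasses (S : SubHodgeStructure H) {m : ℤ} (hm : m + m = n)
    (hS : S.toSubmodule ≤ H.hodgeClasses m) {p q : ℤ} (hp : p ≠ m) : S.toHodgeStructure.hodgeNumber p q = 0 := by
  rw [hodgeNumber, S.piece_toHodgeStructure_eq_bot_of_le_hodgeClasses hm hS hp, finrank_bot]

/-! ## §2 Morphisms out of a pure `(m,m)` structure; `V₀ ≅ ℚ(−m)^{dim V₀}` -/

omit [Module.Finite ℚ V] in
/-- **EVERY `ℚ`-LINEAR MAP OUT OF A PURE `(m,m)` STRUCTURE INTO HODGE VECTORS IS A MORPHISM**: if `Hdgᵐ(H₁) = V₁` (`m + m = n`) and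
`f : V₁ → V₂` takes values in `Hdgᵐ(H₂)`, then `f` underlies a morphism `H₁ → H₂` (`f_ℂ(Fʳ) ⊆ ℂ ⊗ Hdgᵐ(H₂) ⊆ Fᵐ ⊆ Fʳ` for `r ≤ m`, and
`Fʳ(H₁) = 0` for `r > m`). With g41-#1's converse for endomorphisms: the full subcategory of pure `(m,m)` structures is the category of
finite-dimensional `ℚ`-vector spaces. [cite: DeligneHodgeII1971, 2.1.13] [cite: VoisinHodgeI2002, §7.3.1 (p. 148)] [cite: GreenGriffithsKerr2012, §I.A p. 33] -/
theorem exists_hom_toLinearMap_eq_of_hodgeClasses_eq_top {H₁ : HodgeStructure V' n} {H₂ : HodgeStructure V n} {m : ℤ} (hm : m + m = n)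
    (h₁ : H₁.hodgeClasses m = ⊤) (f : V' →ₗ[ℚ] V) (hf : LinearMap.range f ≤ H₂.hodgeClasses m) : ∃ φ : Hom H₁ H₂, φ.toLinearMap = f := by
  refine ⟨⟨f, fun r => ?_⟩, rfl⟩
  rintro _ ⟨x, hx, rfl⟩
  rcases le_or_gt r m with hr | hr
  · exact H₂.antitone_F hr (Submodule.mem_inf.1 (baseChange_apply_mem_F_inf_complexConj_of_range_le₉ H₂ hf x)).1
  · have hx0 : x = 0 := by
      have hx' : x ∈ H₁.F r := hx
      rwa [F_eq_bot_of_hodgeClasses_eq_top₉ H₁ hm h₁ hr, Submodule.mem_bot] at hx'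
    rw [hx0, map_zero]
    exact Submodule.zero_mem _

omit [Module.Finite ℚ V] in
/-- **Two pure `(m,m)` structures with a linear isomorphism between them are isomorphic Hodge structures.**
[cite: DeligneHodgeII1971, 2.1.13] [cite: GreenGriffithsKerr2012, §I.A p. 33] -/
theorem exists_hom_bijective_of_hodgeClasses_eq_top {H₁ : HodgeStructure V' n} {H₂ : HodgeStructure V n} {m : ℤ} (hm : m + m = n)
    (h₁ : H₁.hodgeClasses m = ⊤) (h₂ : H₂.hodgeClasses m = ⊤) (e : V' ≃ₗ[ℚ] V) : ∃ φ : Hom H₁ H₂, Function.Bijective φ.toLinearMap := by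
  obtain ⟨φ, hφ⟩ := exists_hom_toLinearMap_eq_of_hodgeClasses_eq_top hm h₁ (e : V' →ₗ[ℚ] V) (h₂ ▸ le_top)
  exact ⟨φ, by rw [hφ]; exact e.bijective⟩

/-- The tree's structure purely of type `(m,m)` on `W` (`HodgeStructure.pure W m n`) has `Hdgᵐ = W` (the bare form of the tree's
`hodgeClasses_pureOfEven_of_even`, `Motives/BettiRealizationPure`). [cite: DeligneHodgeII1971, 2.1.13] -/
theorem hodgeClasses_pure_eq_top (W : Type v) [AddCommGroup W] [Module ℚ W] (m : ℤ) (hn : n = 2 * m) :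
    (pure W m n hn).hodgeClasses m = ⊤ :=
  eq_top_iff.2 fun w _ => by
    rw [mem_hodgeClasses_iff, pure_F, pureFiltration_of_le le_rfl]
    exact Submodule.mem_top

/-- **`V₀ ≅ ℚ(−m)^{dim V₀}`**: a sub-Hodge structure `S` of Hodge vectors is isomorphic, as a Hodge structure, to the structure purely of
type `(m,m)` on `ℚ^{dim S}` (the tree's `pure (Fin (dim S) → ℚ) m n`, i.e. the direct sum of `dim S` copies of the Tate structure
`ℚ(−m)`). [cite: GreenGriffithsKerr2012, §I.A p. 33 («`ℚ(p)` … pure Hodge type»)] [cite: DeligneHodgeII1971, 2.1.13] -/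
theorem SubHodgeStructure.exists_hom_pure_bijective_of_le_hodgeClasses (S : SubHodgeStructure H) {m : ℤ} (hm : m + m = n)
    (hS : S.toSubmodule ≤ H.hodgeClasses m) :
    ∃ φ : Hom S.toHodgeStructure (pure (Fin (finrank ℚ S.toSubmodule) → ℚ) m n (by omega)), Function.Bijective φ.toLinearMap :=
  exists_hom_bijective_of_hodgeClasses_eq_top hm (S.hodgeClasses_toHodgeStructure_eq_top_of_le hS) (hodgeClasses_pure_eq_top _ m _)
    (Module.finBasis ℚ S.toSubmodule).equivFun

/-! ## §3 The Hodge numbers of `V` split along `V = V₀ ⊕ V₀^⊥` -/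

/-- **`h^{p,q}(V) = h^{p,q}(V₀) + h^{p,q}(V₀^⊥)`**: the inclusion `V₀ ↪ V` and the projection `V ↠ V₀^⊥` along `V₀` are morphisms forming
a (split) short exact sequence of Hodge structures, and Hodge numbers are additive (`Gr_F` is exact). [cite: DeligneHodgeII1971, 1.2.10 (iv)]
[cite: VoisinHodgeI2002, §7.3.1 (p. 148)] -/
theorem Polarization.hodgeNumber_eq_add_of_eq_orthogonal (ψ : Polarization H) {m : ℤ} (hm : m + m = n) {S T : SubHodgeStructure H}
    (hS : S.toSubmodule = H.hodgeClasses m) (hT : T.toSubmodule = ψ.form.orthogonal (H.hodgeClasses m)) (p q : ℤ) :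
    H.hodgeNumber p q = S.toHodgeStructure.hodgeNumber p q + T.toHodgeStructure.hodgeNumber p q := by
  have hc := (ψ.isCompl_of_eq_hodgeClasses_of_eq_orthogonal hm hS hT).symm
  refine hodgeNumber_eq_add_of_exact S.subtypeHom (T.projectionOntoHom S hc) S.toSubmodule.injective_subtype
    (Submodule.projectionOnto_surjective hc) ?_ p q
  rw [LinearMap.exact_iff, SubHodgeStructure.projectionOntoHom_toLinearMap, SubHodgeStructure.subtypeHom_toLinearMap,
    Submodule.ker_projectionOnto, Submodule.range_subtype]

/-- **`h^{m,m}(V) = dim V₀ + h^{m,m}(V₀^⊥)`.** [cite: VoisinHodgeI2002, §7.1.1 and §7.3.1] [cite: GreenGriffithsKerr2012, Ch. V Warning p. 154] -/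
theorem Polarization.hodgeNumber_self_eq_finrank_hodgeClasses_add (ψ : Polarization H) {m : ℤ} (hm : m + m = n) {T : SubHodgeStructure H}
    (hT : T.toSubmodule = ψ.form.orthogonal (H.hodgeClasses m)) :
    H.hodgeNumber m m = finrank ℚ (H.hodgeClasses m) + T.toHodgeStructure.hodgeNumber m m := by
  obtain ⟨S, hS⟩ := ψ.exists_subHodgeStructure_eq_hodgeClasses hm
  rw [ψ.hodgeNumber_eq_add_of_eq_orthogonal hm hS hT, S.hodgeNumber_toHodgeStructure_self_of_le_hodgeClasses hm hS.le, hS]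

/-- **`h^{p,q}(V) = h^{p,q}(V₀^⊥)` for `p ≠ m`** — off the middle, splitting off the Hodge vectors changes nothing.
[cite: VoisinHodgeI2002, §7.1.1 and §7.3.1] [cite: GreenGriffithsKerr2012, Ch. V Warning p. 154] -/
theorem Polarization.hodgeNumber_eq_hodgeNumber_toHodgeStructure_of_ne (ψ : Polarization H) {m : ℤ} (hm : m + m = n) {T : SubHodgeStructure H}
    (hT : T.toSubmodule = ψ.form.orthogonal (H.hodgeClasses m)) {p q : ℤ} (hp : p ≠ m) :
    H.hodgeNumber p q = T.toHodgeStructure.hodgeNumber p q := by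
  obtain ⟨S, hS⟩ := ψ.exists_subHodgeStructure_eq_hodgeClasses hm
  rw [ψ.hodgeNumber_eq_add_of_eq_orthogonal hm hS hT, S.hodgeNumber_toHodgeStructure_eq_zero_of_le_hodgeClasses hm hS.le hp, zero_add]

/-- `h^{m,m}(V₀^⊥) = h^{m,m}(V) − dim V₀`: the transcendental part of `V^{m,m}`, carrying no rational vectors.
[cite: GreenGriffithsKerr2012, Ch. V Warning p. 154] [cite: VoisinHodgeI2002, §7.1.1] -/
theorem Polarization.hodgeNumber_toHodgeStructure_self_eq_sub (ψ : Polarization H) {m : ℤ} (hm : m + m = n) {T : SubHodgeStructure H}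
    (hT : T.toSubmodule = ψ.form.orthogonal (H.hodgeClasses m)) :
    T.toHodgeStructure.hodgeNumber m m = H.hodgeNumber m m - finrank ℚ (H.hodgeClasses m) := by
  rw [ψ.hodgeNumber_self_eq_finrank_hodgeClasses_add hm hT, Nat.add_sub_cancel_left]


end HodgeStructure

end Literature.AlgebraicGeometry.Motives

end
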